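import Summits.CriticalPhenomena.SAWScalingLimit.Theses.SAWRenewalTightness
import Summits.CriticalPhenomena.SAWScalingLimit.Theorems.AnnularMassDecay.Negative.LoadBearing

/-!
# Line `kesten-bridge-reference-measure` for the crux `SAWRenewalTightness.AnnularMassDecay` (stmt-CriticalPhenomena-4729)

Skeleton (crux-plan, round 1, 2026-08-16).  The crux (lattice units on `ℤ²`, `x_c = 1/μ`):
`∃ θ > 0, C, ∀ z r R, 1 ≤ r < R → ∀ u, R ≤ |u − z| → ∀ N, annMass z r R u N ≤ C (r/R)^θ`, where
`annMass` (landed `Negative.LoadBearing`, `annularMassDecay_iff : AnnularMassDecay ↔ … := Iff.rfl`) is the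
`x_c`-mass of SAWs from `u` confined to the open annulus and killed at first entry of the closed disc `B̄(z,r)`.

## The lever (card `Ideas/kesten-bridge-reference-measure.md`, merged per TRIAGE-r1-{1,2,3} with the two cards
sharing it, `normal-kesten-closure-domination` and `kesten-measure-pricing`)

KESTEN'S INFINITE BRIDGE AS THE REFERENCE MEASURE.  In the tangent frame at `u` pointing to `z`
(level `lvl u z v = Re((v − u)·conj(z − u))`, an arbitrary — generally irrational — direction) the open disc
`D_R(z)`, `R ≤ |u − z|`, lies in the open half-plane `{lvl > 0}` (`lvl_pos_of_dist_lt`, PROVED here), so every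
annular bridge of the crux is a HALF-PLANE FIRST-ENTRY PREFIX of the ball `B̄(z,r)` (`IsEntry`; inclusion
`annMass_le_entryMass`, PROVED here).  Price this prefix-free family under Kesten's i.i.d.-irreducible-bridge
(sub)probability measure `P_K` of the frame (legitimate in every direction because only `A(x_c) ≤ 1` is used):
continue each prefix `π` to its first weak level record at or after the tip (`IsClosure`, weight `esc π`); the
closures `{πη}` are a prefix-free family of frame bridges through the ball, so by unique factorisation into
irreducible bridges and the Kraft inequality their mass is at most the `P_K`-probability that the infinite bridge
`Γ` from `u` VISITS `B̄(z,r)` — typed as the mass `kestenHitMass` of the code words "first irreducible piece that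
visits the ball" (`IsFirstHit`).  Hence, for any threshold `κ > 0` (`entryMass_le_split`, PROVED here),

    entryMass ≤ κ⁻¹ · escEntryMass + trappedMass κ ≤ κ⁻¹ · kestenHitMass + trappedMass κ,

and the crux becomes: a ONE-ARM (hitting) ESTIMATE for a genuine regenerative random path (`stub_kestenOneArm`,
the research core) + an anti-trapping statement in its weakest, AVERAGED form (`stub_averagedUntrapping`:
`entryMass ≤ C₀ · escEntryMass`, i.e. closure weights are `≥ 1/C₀` on `x_c`-average; the card's absolute
`Trap(κ₀)` is too strong — a prefix winding once around the ball has `esc = 0` and such prefixes carry a positive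
fraction of the mass, TRIAGE-r1-2 — and the relative threshold form `RelativeUntrapping` is kept as a proved
sufficient condition, not as the obligation).

## Registered stubs (sorry ONLY inside these four theorems; statements = `Sig.stub_<name>`)

* `stub_closureDomination` (M; provable now) — `escEntryMass u z r N K ≤ kestenHitMass u z r (N + K)` for
  `r < |u − z|`: completion/closure pricing = prefix-freeness of `{πη}` + unique factorisation + Kraft–McMillan
  over the irreducible-bridge alphabet of the frame (`A^e(x_c) ≤ 1` from `b^e_n ≤ c_n`, `c_n^{1/n} → μ`).
* `stub_kestenHitLeOne` (M; provable now) — `kestenHitMass ≤ 1`: the code words are prefix-free; Kraft.  Not used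
  by `AnnularMassDecay_of`; with stubs 1 and 3 it gives the `θ = 0` half of the crux (`annularMassBounded_of`,
  PROVED modulo stubs) — the milestone "uniform boundedness", itself open (Disproof §E/§F(v)).
* `stub_kestenOneArm` (XL; HARDEST) — `∃ θ > 0, C: kestenHitMass u z r N ≤ C (r/R)^θ` for `1 ≤ r < R ≤ |u − z|`:
  Kesten's infinite bridge started at distance `≥ R` passes through the `r`-ball on its own axis with probability
  `≤ C (r/R)^θ` — quantitative non-space-filling of a path with i.i.d. regeneration (card (H1'); DC–Hammond
  arXiv:1205.0401 §4 ergodic structure, DGHM arXiv:1305.1257 delocalisation technology; predicted `θ = 2/3`).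
* `stub_averagedUntrapping` (L–XL) — `∃ C₀: entryMass ≤ C₀ · escEntryMass` eventually in `N` (card (H2) = the
  SAWNotKineticallyGrown residue, met head-on, in the averaged form; the threshold form `RelativeUntrapping`
  `∃ κ δ: trappedMass κ ≤ (1 − δ)·entryMass` implies it, `averagedUntrapping_of_relative`, PROVED).

`AnnularMassDecay_of : Sig.stub_closureDomination → Sig.stub_kestenOneArm → Sig.stub_averagedUntrapping →
AnnularMassDecay` is sorry-free (inclusion + `entryMass ≤ C₀·escEntryMass ≤ C₀·kestenHitMass ≤ C₀ C (r/R)^θ`;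
constant `max C₀ 0 · C`, same `θ`).

## Disproof used (Cruxes/AnnularMassDecay/Disproof.lean cycle 2 + landed `Negative/LoadBearing` — imported above
so this scratch check sees it — and `Negative/HalfPlaneDivergence`, read; not imported only because the farm had not
built it yet at filing time)

`false_without_startOutside` (`R ≤ |u − z|` load-bearing): USED at the first step — it is what puts the disc in
the open half-plane of the frame (`annMass_le_entryMass` takes `R ≤ dist u z`), i.e. what makes `u` a boundary
point for Kesten's structure; `stub_kestenOneArm` keeps the hypothesis verbatim.  `false_without_endInside`
(endpoint clause load-bearing): first entrance is the prefix-freeness engine of stubs 1–2 (`IsEntry` keeps the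
clause; `IsFirstHit` asks for a visit).  `annularMassDecay_false_without_avoidInner` / `halfPlanePartialSum_unbounded`
(inner avoidance load-bearing, `H(x_c) = ∞`): `IsEntry` keeps "interior avoids `B̄(z,r)`" verbatim, so the counted
family stays prefix-free and never contains the hung half-plane walks of that witness.  `false_without_innerRadiusOne`
(`1 ≤ r` load-bearing): kept in stubs 3–4 (a sub-lattice ball around an axis point is visited with probability
bounded below while `(r/R)^θ → 0`).  `annularMassDecay_iff_posR` (`r < R` cosmetic) and `const_ge_of_bound`
(`C ≥ x_c 2^θ`): consistent (the line's constant is `max C₀ 0 · C`; `C₀ ≥ 1` is forced by the one-step entries).  §F(v)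
"annular bridges are not submultiplicative": nothing here concatenates annular bridges — the only junctions are
renewal points of the frame, inside `P_K`.  §H (RKI numerically false off-lattice) concerns the sibling radial line,
not this one: no radial kernel appears here.  Negatives index (`ledger negatives`): no refuted statement about
`x_c`-masses of walks exists; nothing refuted is restated.
-/

noncomputable section

open scoped BigOperators Classical
open Finset Literature.Probability.LatticeModels Literature.Probability.RandomPlanarGeometry
open Summit.CriticalPhenomena.SAWScalingLimit.Theses.SAWRenewalTightness (AnnularMassDecay)
open Summit.CriticalPhenomena.SAWScalingLimit.Theorems.AnnularMassDecay.Negative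
  (annMass annularMassDecay_iff criticalFugacity_pos annMass_nonneg)

namespace Summit.CriticalPhenomena.SAWScalingLimit.Cruxes.AnnularMassDecay.KestenBridgeReferenceMeasure

/-! ## Objects of the line (all over `SAW.Zd.saws`, `SAW.criticalFugacity`, `Site.toComplex`) -/

/-- Shorthand `x_c = 1/μ(ℤ²)`. -/
abbrev xc : ℝ := SAW.criticalFugacity

theorem xc_nonneg : 0 ≤ xc := criticalFugacity_pos.le

/-- **Level** of the point `v ∈ ℂ` in the Kesten frame at the lattice point `u` pointing to `z`:
`lvl u z v = Re((v − u) · conj (z − u)) = ⟨v − u, z − u⟩` (unnormalised: the unit of level is `|z − u|`; only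
signs and comparisons of levels are ever used, so no normalisation and no rationality of the direction is needed). -/
def lvl (u : Site 2) (z : ℂ) (v : ℂ) : ℝ :=
  ((v - Site.toComplex u) * (starRingEnd ℂ) (z - Site.toComplex u)).re

/-- `ω ∈ saws 2 n`, shifted to start at `u`, is a **half-plane first-entry prefix** of the closed ball `B̄(z,r)`
in the frame `(u, z)`: strictly positive level at every time `1 ≤ i ≤ n` (Kesten/Madras–Slade half-plane walk
from the boundary point `u`), interior vertices outside the closed ball, endpoint in it. Compared with the
crux's filter, the outer confinement `|· − z| < R` is replaced by the half-plane condition it implies. -/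
def IsEntry (u : Site 2) (z : ℂ) (r : ℝ) (n : ℕ) (ω : ℕ → Site 2) : Prop :=
  (∀ i, 0 < i → i ≤ n → 0 < lvl u z (Site.toComplex (u + ω i))) ∧
  (∀ i, 0 < i → i < n → r < dist (Site.toComplex (u + ω i)) z) ∧
  dist (Site.toComplex (u + ω n)) z ≤ r

/-- The first-entry prefixes of length `n`. -/
def entries (u : Site 2) (z : ℂ) (r : ℝ) (n : ℕ) : Finset (ℕ → Site 2) :=
  (SAW.Zd.saws 2 n).filter (IsEntry u z r n)

/-- **Half-plane first-entry mass** (partial sum over lengths `≤ N`). -/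
def entryMass (u : Site 2) (z : ℂ) (r : ℝ) (N : ℕ) : ℝ :=
  ∑ n ∈ range (N + 1), ∑ _ω ∈ entries u z r n, xc ^ n

/-- `w` (from `0`, shifted to `u`), read up to time `m`, is a **bridge of the frame** (Madras–Slade Def. 1.2.4
with the first coordinate replaced by `lvl`): positive level after time `0`, endpoint a weak level maximum. -/
def IsFrameBridge (u : Site 2) (z : ℂ) (m : ℕ) (w : ℕ → Site 2) : Prop :=
  (∀ i, 0 < i → i ≤ m → 0 < lvl u z (Site.toComplex (u + w i))) ∧
  (∀ i, i ≤ m → lvl u z (Site.toComplex (u + w i)) ≤ lvl u z (Site.toComplex (u + w m)))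

/-- `j` is a **break (renewal) time** of the length-`m` walk `w` in the frame (Madras–Slade (4.2.1) with
`lvl`): levels up to time `j` are `≤` the level at `j`, later levels are strictly larger. The irreducible
pieces of a frame bridge are delimited by its break times. -/
def IsBreakTime (u : Site 2) (z : ℂ) (m : ℕ) (w : ℕ → Site 2) (j : ℕ) : Prop :=
  0 < j ∧ j < m ∧ (∀ i, i ≤ j → lvl u z (Site.toComplex (u + w i)) ≤ lvl u z (Site.toComplex (u + w j))) ∧
    ∀ i, j < i → i ≤ m → lvl u z (Site.toComplex (u + w j)) < lvl u z (Site.toComplex (u + w i))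

/-- `w ∈ saws 2 (n + k)` is a **record closure** of its own length-`n` prefix: `w` is a frame bridge of length
`n + k` and NO time `t ∈ [n, n + k)` is a weak level record of `w` (some earlier level is strictly higher).
So the end `n + k` is the FIRST weak record at or after the tip `n`; `k = 0` iff the tip is itself a record
(the card's "monotone class"). The closures of distinct first-entry prefixes, and distinct closures of one
prefix, are never prefixes of one another. -/
def IsClosure (u : Site 2) (z : ℂ) (n k : ℕ) (w : ℕ → Site 2) : Prop :=
  IsFrameBridge u z (n + k) w ∧
  ∀ t, n ≤ t → t < n + k → ∃ i, i < t ∧ lvl u z (Site.toComplex (u + w t)) < lvl u z (Site.toComplex (u + w i))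

/-- **Closure (escape) weight** of the length-`n` prefix `ω`: `x_c`-mass of its record closures by at most `K`
further steps. For `A(x_c) = 1` and `K → ∞` this is `x_c^{-n} · P_K(Γ ⊇ ω and Γ's first weak record after the
tip closes ω)`; it is `≥ 1` on the monotone class. -/
def esc (u : Site 2) (z : ℂ) (n : ℕ) (ω : ℕ → Site 2) (K : ℕ) : ℝ :=
  ∑ k ∈ range (K + 1),
    ∑ _w ∈ (SAW.Zd.saws 2 (n + k)).filter (fun w => (∀ i, i ≤ n → w i = ω i) ∧ IsClosure u z n k w), xc ^ k

/-- **Closure-weighted first-entry mass** `Σ_π x_c^{|π|} · esc π`. -/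
def escEntryMass (u : Site 2) (z : ℂ) (r : ℝ) (N K : ℕ) : ℝ :=
  ∑ n ∈ range (N + 1), ∑ ω ∈ entries u z r n, xc ^ n * esc u z n ω K

/-- **Trapped mass**: first-entry prefixes whose closure weight (within `K` steps) is below the threshold `κ`. -/
def trappedMass (u : Site 2) (z : ℂ) (r κ : ℝ) (N K : ℕ) : ℝ :=
  ∑ n ∈ range (N + 1), ∑ _ω ∈ (entries u z r n).filter (fun ω => esc u z n ω K < κ), xc ^ n

/-- `w` is a **first-hit code word**: a frame bridge that visits `B̄(z,r)` at some positive time, and whose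
every break time `j` has no visit in `(0, j]` — i.e. `w = β₁⋯β_m` (irreducible pieces) with `β_m` the FIRST
piece visiting the ball. These words are prefix-free as sequences of irreducible bridges, so for `A(x_c) = 1`
their total mass is `P_K(the infinite bridge Γ from u visits B̄(z,r))`. -/
def IsFirstHit (u : Site 2) (z : ℂ) (r : ℝ) (m : ℕ) (w : ℕ → Site 2) : Prop :=
  IsFrameBridge u z m w ∧ (∃ i, 0 < i ∧ i ≤ m ∧ dist (Site.toComplex (u + w i)) z ≤ r) ∧
    ∀ j, IsBreakTime u z m w j → ∀ i, 0 < i → i ≤ j → r < dist (Site.toComplex (u + w i)) z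

/-- **Kesten hitting mass** (partial sum over code words of length `≤ N`): the mass form of
`P_K(Γ visits B̄(z,r))`. -/
def kestenHitMass (u : Site 2) (z : ℂ) (r : ℝ) (N : ℕ) : ℝ :=
  ∑ m ∈ range (N + 1), ∑ _w ∈ (SAW.Zd.saws 2 m).filter (IsFirstHit u z r m), xc ^ m

/-- The `θ = 0` content of the crux (uniform boundedness of the annular-bridge mass; by-product target). -/
def AnnularMassBounded : Prop :=
  ∃ C : ℝ, ∀ (z : ℂ) (r R : ℝ), 1 ≤ r → r < R → ∀ u : Site 2, R ≤ dist (Site.toComplex u) z →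
    ∀ N : ℕ, annMass z r R u N ≤ C

/-! ## Elementary facts (proved) -/

theorem esc_nonneg (u : Site 2) (z : ℂ) (n : ℕ) (ω : ℕ → Site 2) (K : ℕ) : 0 ≤ esc u z n ω K :=
  sum_nonneg fun k _ => sum_nonneg fun _ _ => pow_nonneg xc_nonneg k

theorem entryMass_nonneg (u : Site 2) (z : ℂ) (r : ℝ) (N : ℕ) : 0 ≤ entryMass u z r N :=
  sum_nonneg fun n _ => sum_nonneg fun _ _ => pow_nonneg xc_nonneg n

theorem kestenHitMass_nonneg (u : Site 2) (z : ℂ) (r : ℝ) (N : ℕ) : 0 ≤ kestenHitMass u z r N :=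
  sum_nonneg fun m _ => sum_nonneg fun _ _ => pow_nonneg xc_nonneg m

/-- `annMass` is monotone in the truncation `N` (nonnegative terms). -/
theorem annMass_mono (z : ℂ) (r R : ℝ) (u : Site 2) {N M : ℕ} (h : N ≤ M) :
    annMass z r R u N ≤ annMass z r R u M := by
  unfold annMass
  exact sum_le_sum_of_subset_of_nonneg (range_mono (by omega))
    fun n _ _ => sum_nonneg fun _ _ => pow_nonneg xc_nonneg n

/-- **Geometry (G) of the card.** If `v` is strictly closer to `z` than the lattice point `u` is, then `v` has
strictly positive level in the frame at `u` pointing to `z`: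
`⟨v − u, z − u⟩ = ⟨v − z, z − u⟩ + |z − u|² ≥ |z − u| (|z − u| − |v − z|) > 0`.  In particular the open
disc `D_R(z)`, `R ≤ |u − z|`, lies in the open half-plane of the frame. -/
theorem lvl_pos_of_dist_lt {u : Site 2} {z v : ℂ} (h : dist v z < dist (Site.toComplex u) z) :
    0 < lvl u z v := by
  unfold lvl
  set U : ℂ := Site.toComplex u with hU
  set a : ℂ := v - z with ha
  set b : ℂ := z - U with hb
  have hab : v - U = a + b := by rw [ha, hb]; ring
  have hna : ‖a‖ < ‖b‖ := by
    rw [ha, hb, ← dist_eq_norm, ← dist_eq_norm, dist_comm z U]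
    exact h
  have hbpos : 0 < ‖b‖ := lt_of_le_of_lt (norm_nonneg a) hna
  rw [hab, add_mul, Complex.add_re]
  have h1 : (b * (starRingEnd ℂ) b).re = ‖b‖ ^ 2 := by
    rw [Complex.mul_conj, Complex.ofReal_re, Complex.normSq_eq_norm_sq]
  have h2 : -(‖a‖ * ‖b‖) ≤ (a * (starRingEnd ℂ) b).re := by
    have hre := Complex.abs_re_le_norm (a * (starRingEnd ℂ) b)
    rw [norm_mul, Complex.norm_conj] at hre
    exact (abs_le.1 hre).1
  have h3 : ‖a‖ * ‖b‖ < ‖b‖ * ‖b‖ := mul_lt_mul_of_pos_right hna hbpos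
  nlinarith [h1, h2, h3]

/-- **Inclusion.** Every annular bridge of the crux is a half-plane first-entry prefix of the frame
(interior points lie in `D_R(z)`, the endpoint in `B̄(z,r) ⊆ D_R(z)`, and `R ≤ |u − z|`), so
`annMass z r R u N ≤ entryMass u z r N` termwise. Uses the load-bearing `R ≤ dist u z`. -/
theorem annMass_le_entryMass {z : ℂ} {r R : ℝ} {u : Site 2} (hrR : r < R)
    (hR : R ≤ dist (Site.toComplex u) z) (N : ℕ) : annMass z r R u N ≤ entryMass u z r N := by
  unfold annMass entryMass entries
  refine sum_le_sum fun n _ => ?_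
  refine sum_le_sum_of_subset_of_nonneg ?_ fun _ _ _ => pow_nonneg xc_nonneg n
  intro ω hω
  rw [mem_filter] at hω ⊢
  obtain ⟨hsaw, hint, hend⟩ := hω
  refine ⟨hsaw, ?_, fun i hi hin => (hint i hi hin).1, hend⟩
  intro i hi hin
  apply lvl_pos_of_dist_lt
  rcases lt_or_eq_of_le hin with hlt | rfl
  · exact (hint i hi hlt).2.trans_le hR
  · exact (hend.trans_lt hrR).trans_le hR

/-- **Threshold split (the card's bookkeeping, with `1 + κ⁻¹` sharpened to `κ⁻¹` by record closures).**
For every `κ > 0`: untrapped prefixes (`esc ≥ κ`) are paid for by `κ⁻¹ · x_c^{|π|} esc π`, trapped ones are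
kept: `entryMass ≤ κ⁻¹ · escEntryMass + trappedMass κ`. -/
theorem entryMass_le_split (u : Site 2) (z : ℂ) (r : ℝ) {κ : ℝ} (hκ : 0 < κ) (N K : ℕ) :
    entryMass u z r N ≤ κ⁻¹ * escEntryMass u z r N K + trappedMass u z r κ N K := by
  unfold entryMass escEntryMass trappedMass
  rw [mul_sum, ← sum_add_distrib]
  refine sum_le_sum fun n _ => ?_
  rw [← sum_filter_add_sum_filter_not (entries u z r n) (fun ω => esc u z n ω K < κ) (fun _ => xc ^ n),
    add_comm]
  refine add_le_add ?_ le_rfl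
  rw [mul_sum]
  calc ∑ ω ∈ (entries u z r n).filter (fun ω => ¬ esc u z n ω K < κ), xc ^ n
      ≤ ∑ ω ∈ (entries u z r n).filter (fun ω => ¬ esc u z n ω K < κ), κ⁻¹ * (xc ^ n * esc u z n ω K) := by
        refine sum_le_sum fun ω hω => ?_
        have hge : κ ≤ esc u z n ω K := not_lt.1 (mem_filter.1 hω).2
        have hone : 1 ≤ κ⁻¹ * esc u z n ω K := by
          rw [inv_mul_eq_div, le_div_iff₀ hκ, one_mul]
          exact hge
        calc xc ^ n = xc ^ n * 1 := (mul_one _).symm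
          _ ≤ xc ^ n * (κ⁻¹ * esc u z n ω K) := mul_le_mul_of_nonneg_left hone (pow_nonneg xc_nonneg n)
          _ = κ⁻¹ * (xc ^ n * esc u z n ω K) := by ring
    _ ≤ ∑ ω ∈ entries u z r n, κ⁻¹ * (xc ^ n * esc u z n ω K) :=
        sum_le_sum_of_subset_of_nonneg (filter_subset _ _) fun ω _ _ =>
          mul_nonneg (inv_nonneg.2 hκ.le) (mul_nonneg (pow_nonneg xc_nonneg n) (esc_nonneg u z n ω K))

/-! ## Stub signatures (`Sig.stub_<name>`; the registered obligations below restate them by name) -/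

namespace Sig

/-- **STUB 1 · closure domination** (completion pricing; size M, provable now).  For a ball not containing the
start, the closure-weighted first-entry mass is at most the Kesten hitting mass at truncation `N + K`:
map `(π, η) ↦ w = πη` (injective: `π` = prefix up to first entrance; `{πη}` is prefix-free by "first weak record
≥ tip"), factor the frame bridge `w` into irreducible bridges, let `w*` be its shortest piece-prefix with a visit
at a positive time (`w* ∈ IsFirstHit`, `|w*| ≤ N + K`), and bound the tails over each `w*` — a prefix-free set of
complete code words over the irreducible-bridge alphabet of the frame based at the renewal point `end w*` — by the
Kraft–McMillan inequality with letter weights summing to `A^e(x_c) ≤ 1` (from `b^e_n ≤ c_n` and `c_n^{1/n} → μ`,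
Madras–Slade (1.2.9), (4.2.2)–(4.2.4); no unfolding, no lattice symmetry of the direction).  Sources: Kesten1963SAW §4;
MadrasSlade1993 §4.2; DuminilCopinHammond2013 = arXiv:1205.0401 §2.3 (`P_{iSAB}^{⊗ℕ}`). -/
def stub_closureDomination : Prop :=
  ∀ (u : Site 2) (z : ℂ) (r : ℝ), r < dist (Site.toComplex u) z → ∀ N K : ℕ,
    escEntryMass u z r N K ≤ kestenHitMass u z r (N + K)

/-- **STUB 2 · the Kesten hitting mass is a (sub)probability** (size M, provable now): the first-hit code words
are prefix-free as words over irreducible frame bridges, so Kraft gives `kestenHitMass ≤ 1` — the mass form of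
`P_K(Γ visits B̄(z,r)) ≤ 1`.  Feeds only the `θ = 0` by-product `annularMassBounded_of`. Sources as for stub 1. -/
def stub_kestenHitLeOne : Prop :=
  ∀ (u : Site 2) (z : ℂ) (r : ℝ) (N : ℕ), kestenHitMass u z r N ≤ 1

/-- **STUB 3 · one-arm (hitting) estimate for Kesten's infinite bridge** (size XL; the HARDEST stub, card (H1')).
Started at a boundary point at distance `≥ R` from `z`, the infinite bridge of the frame passes through the
`r`-ball about the axis point `z` with probability `≤ C (r/R)^θ`, SOME `θ > 0` (predicted `2 − d_f = 2/3`), in the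
mass form `kestenHitMass`.  A statement about a path with i.i.d. regeneration (union bounds, reflection symmetry
of the piece law, LLN/ergodicity along renewals, multi-valued maps on a probability space), equivalently a
quantitative non-space-filling statement (DKY arXiv:1110.3074 Problem 10 flavour).  Why it might fail / cost: a
uniform power law in `r/R` forces lateral spreading of `Γ` on scale `≍ R` at level `R` (a diffusive concatenation
of small pieces would hit every ball of radius `≥ √R`), hence heavy-tailed renewal structure on `ℤ²` — of
bridge-decay strength (KP arXiv:2310.17299 p.2; hexagonal only).  `1 ≤ r` and `R ≤ |u − z|` are load-bearing
(Disproof `false_without_innerRadiusOne/startOutside`).  Sources: arXiv:1205.0401 §4, arXiv:1305.1257,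
LawlerSchrammWerner2004SAW (exponent), arXiv:1110.3074 Problem 10. -/
def stub_kestenOneArm : Prop :=
  ∃ θ C : ℝ, 0 < θ ∧ ∀ (u : Site 2) (z : ℂ) (r R : ℝ), 1 ≤ r → r < R →
    R ≤ dist (Site.toComplex u) z → ∀ N : ℕ, kestenHitMass u z r N ≤ C * (r / R) ^ θ

/-- **STUB 4 · averaged un-trapping (closure-weight floor on `x_c`-average)** (size L–XL; card (H2)).  There
is `C₀` such that for every ball of radius `≥ 1` not containing the start and all large truncations `N` (some
`K`): `entryMass ≤ C₀ · escEntryMass` — on `x_c^{|π|}`-average the closure weight of a first-entry prefix is at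
least `1/C₀`.  This is the WEAKEST form of the card's anti-trapping atom and the one the composition consumes:
the card's absolute `Trap(κ₀) ≤ C (r/R)^θ` is too strong (a prefix winding once around the ball has `esc = 0` and
such prefixes carry a positive fraction of the mass, TRIAGE-r1-2), and even the relative threshold form
`RelativeUntrapping` below (sibling card's UB: prefixes with `esc < κ` carry at most `1 − δ` of the mass) is
strictly stronger (`averagedUntrapping_of_relative`, PROVED) and is suspect at astronomically large `R/r`: tight
full turns of the prefix around `z` occur at a positive density of scales, each costs the closure an `O(1)`
factor, so the untrapped FRACTION plausibly decays like `(r/R)^{b₀}` with a tiny `b₀ > 0`, whereas the AVERAGE is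
carried by exposed tips whose closure weight grows like `(record distance)^{1/16}` (slit-tip exponent 5/16);
exponent bookkeeping (`x_b = 5/8`, `x_1 = 5/48`, `d_f = 4/3`): `escEntryMass ≍ P_K(hit) ≍ (r/R)^{2/3}` against
`entryMass ≍ R^{-1/4}(r/R)^{23/48}`, ratio `≍ R^{1/4}(r/R)^{3/16} ≥ R^{3/48}` using `r ≥ 1` — so the averaged form
holds with room and `1 ≤ r` is load-bearing for it (Disproof `false_without_innerRadiusOne`).  Why it might fail:
it is an averaged LOWER bound on continuation masses from random tips — no constant-strength lower-bound
technology exists on `ℤ²` (the intended tools: a multi-valued unsealing map, DGHM/Hammond style, plus Kesten's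
pattern theorem, in tree `SAWPatternTheorem`); with stubs 1–2 it already yields `θ = 0` (uniform boundedness,
open: Disproof §E), so it is at least that hard.  Sources: arXiv:1205.0401, arXiv:1305.1257, MadrasSlade1993 §7,
DuplantierSaleur1986 (tip/wedge exponents), Literature.Barriers.CriticalPhenomena.SAWNotKineticallyGrown. -/
def stub_averagedUntrapping : Prop :=
  ∃ C₀ : ℝ, ∀ (u : Site 2) (z : ℂ) (r : ℝ), 1 ≤ r → r < dist (Site.toComplex u) z →
    ∃ N₀ : ℕ, ∀ N : ℕ, N₀ ≤ N → ∃ K : ℕ, entryMass u z r N ≤ C₀ * escEntryMass u z r N K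

end Sig

/-- The RELATIVE THRESHOLD form of un-trapping (sibling card's UB; the card's `Trap(κ₀)` made relative as
TRIAGE-r1-2 demands): prefixes with closure weight `< κ` carry at most a fraction `1 − δ` of the first-entry
mass. NOT a stub: it implies the registered averaged form (`averagedUntrapping_of_relative`) and is kept as the
natural intermediate target / numerical observable (trapped fraction at threshold `κ`). -/
def RelativeUntrapping : Prop :=
  ∃ κ δ : ℝ, 0 < κ ∧ 0 < δ ∧ ∀ (u : Site 2) (z : ℂ) (r : ℝ), 1 ≤ r → r < dist (Site.toComplex u) z →
    ∃ N₀ : ℕ, ∀ N : ℕ, N₀ ≤ N → ∃ K : ℕ, trappedMass u z r κ N K ≤ (1 - δ) * entryMass u z r N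

/-- Threshold ⟹ average: relative un-trapping with `(κ, δ)` gives the averaged floor with `C₀ = 1/(κδ)`
(threshold split `entryMass_le_split` + `δ · E ≤ κ⁻¹ · escE`). -/
theorem averagedUntrapping_of_relative (h : RelativeUntrapping) : Sig.stub_averagedUntrapping := by
  obtain ⟨κ, δ, hκ, hδ, hU⟩ := h
  refine ⟨1 / (κ * δ), fun u z r hr hruz => ?_⟩
  obtain ⟨N₀, hN₀⟩ := hU u z r hr hruz
  refine ⟨N₀, fun N hN => ?_⟩
  obtain ⟨K, hK⟩ := hN₀ N hN
  refine ⟨K, ?_⟩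
  have h1 := entryMass_le_split u z r hκ N K
  have h3 : δ * entryMass u z r N ≤ κ⁻¹ * escEntryMass u z r N K := by nlinarith [h1, hK]
  rw [one_div_mul_eq_div, le_div_iff₀ (mul_pos hκ hδ)]
  have h4 : entryMass u z r N * (κ * δ) = κ * (δ * entryMass u z r N) := by ring
  rw [h4]
  calc κ * (δ * entryMass u z r N) ≤ κ * (κ⁻¹ * escEntryMass u z r N K) :=
        mul_le_mul_of_nonneg_left h3 hκ.le
    _ = escEntryMass u z r N K := by rw [← mul_assoc, mul_inv_cancel₀ hκ.ne', one_mul]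

/-! ## The registered stubs (`sorry` lives only in these four theorems) -/

/-- Registered stub 1 — closure domination (M, provable now). See `Sig.stub_closureDomination`. -/
theorem stub_closureDomination : Sig.stub_closureDomination := by
  sorry

/-- Registered stub 2 — `kestenHitMass ≤ 1` (M, provable now; `θ = 0` by-product only). See `Sig.stub_kestenHitLeOne`. -/
theorem stub_kestenHitLeOne : Sig.stub_kestenHitLeOne := by
  sorry

/-- Registered stub 3 — one-arm estimate for Kesten's infinite bridge (XL, hardest). See `Sig.stub_kestenOneArm`. -/
theorem stub_kestenOneArm : Sig.stub_kestenOneArm := by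
  sorry

/-- Registered stub 4 — averaged un-trapping (L–XL). See `Sig.stub_averagedUntrapping`. -/
theorem stub_averagedUntrapping : Sig.stub_averagedUntrapping := by
  sorry

/-! ## Composition (sorry-free): the stubs imply the crux BY NAME -/

/-- The half-plane estimate behind both compositions: averaged un-trapping with constant `C₀`, closure
domination and a bound `B` on the Kesten hitting mass give `entryMass ≤ max C₀ 0 · B` for all large `N`. -/
theorem entryMass_le_of_hitBound {u : Site 2} {z : ℂ} {r C₀ B : ℝ} {N₀ : ℕ}
    (havg : ∀ N : ℕ, N₀ ≤ N → ∃ K : ℕ, entryMass u z r N ≤ C₀ * escEntryMass u z r N K)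
    (hdom : ∀ N K : ℕ, escEntryMass u z r N K ≤ kestenHitMass u z r (N + K))
    (hhit : ∀ N : ℕ, kestenHitMass u z r N ≤ B) {N : ℕ} (hN : N₀ ≤ N) :
    entryMass u z r N ≤ max C₀ 0 * B := by
  obtain ⟨K, hK⟩ := havg N hN
  have hE : 0 ≤ escEntryMass u z r N K :=
    sum_nonneg fun n _ => sum_nonneg fun ω _ => mul_nonneg (pow_nonneg xc_nonneg n) (esc_nonneg u z n ω K)
  calc entryMass u z r N ≤ C₀ * escEntryMass u z r N K := hK
    _ ≤ max C₀ 0 * escEntryMass u z r N K := mul_le_mul_of_nonneg_right (le_max_left _ _) hE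
    _ ≤ max C₀ 0 * B := mul_le_mul_of_nonneg_left ((hdom N K).trans (hhit (N + K))) (le_max_right _ _)

/-- **`AnnularMassDecay_of`** — the line concludes the crux BY NAME: inclusion of the annular bridges in the
half-plane first-entry family (`annMass_le_entryMass`, geometry (G)), averaged un-trapping (stub 4), closure
domination (stub 1) and the one-arm bound for Kesten's bridge (stub 3); the crux holds with the SAME `θ` and the
constant `max C₀ 0 · C`. Monotonicity in `N` (`annMass_mono`) absorbs the "for all large `N`" of stub 4. -/
theorem AnnularMassDecay_of (hdom : Sig.stub_closureDomination) (harm : Sig.stub_kestenOneArm)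
    (havg : Sig.stub_averagedUntrapping) : AnnularMassDecay := by
  rw [annularMassDecay_iff]
  obtain ⟨θ, C, hθ, hhit⟩ := harm
  obtain ⟨C₀, hU⟩ := havg
  refine ⟨θ, max C₀ 0 * C, hθ, fun z r R hr hrR u huz N => ?_⟩
  have hruz : r < dist (Site.toComplex u) z := hrR.trans_le huz
  obtain ⟨N₀, hN₀⟩ := hU u z r hr hruz
  have hE : entryMass u z r (max N N₀) ≤ max C₀ 0 * (C * (r / R) ^ θ) :=
    entryMass_le_of_hitBound hN₀ (hdom u z r hruz) (hhit u z r R hr hrR huz) (le_max_right _ _)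
  calc annMass z r R u N ≤ annMass z r R u (max N N₀) := annMass_mono z r R u (le_max_left _ _)
    _ ≤ entryMass u z r (max N N₀) := annMass_le_entryMass hrR huz _
    _ ≤ max C₀ 0 * (C * (r / R) ^ θ) := hE
    _ = max C₀ 0 * C * (r / R) ^ θ := by ring

/-- Wiring check: the registered stubs feed `AnnularMassDecay_of` as stated (kept an `example` so that
`AnnularMassDecay_of` is the only theorem of the file concluding the crux). -/
example : AnnularMassDecay :=
  AnnularMassDecay_of stub_closureDomination stub_kestenOneArm stub_averagedUntrapping

/-! ## By-product (sorry-free modulo stubs 1, 2, 4): the `θ = 0` half of the crux -/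

/-- **`annularMassBounded_of`** — closure domination, `kestenHitMass ≤ 1` and averaged un-trapping already give
UNIFORM BOUNDEDNESS of the annular-bridge mass (`C = max C₀ 0`), the `θ = 0` content that Disproof §E/§F(v) records
as open ("`G_{z_c}` finite" strength). The line's first milestone and the calibration of stub 4. -/
theorem annularMassBounded_of (hdom : Sig.stub_closureDomination) (hle : Sig.stub_kestenHitLeOne)
    (havg : Sig.stub_averagedUntrapping) : AnnularMassBounded := by
  obtain ⟨C₀, hU⟩ := havg
  refine ⟨max C₀ 0 * 1, fun z r R hr hrR u huz N => ?_⟩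
  have hruz : r < dist (Site.toComplex u) z := hrR.trans_le huz
  obtain ⟨N₀, hN₀⟩ := hU u z r hr hruz
  calc annMass z r R u N ≤ annMass z r R u (max N N₀) := annMass_mono z r R u (le_max_left _ _)
    _ ≤ entryMass u z r (max N N₀) := annMass_le_entryMass hrR huz _
    _ ≤ max C₀ 0 * 1 := entryMass_le_of_hitBound hN₀ (hdom u z r hruz) (hle u z r) (le_max_right _ _)

example : AnnularMassBounded :=
  annularMassBounded_of stub_closureDomination stub_kestenHitLeOne stub_averagedUntrapping

/-- The relative threshold form also closes the line (through `averagedUntrapping_of_relative`). -/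
example (hdom : Sig.stub_closureDomination) (harm : Sig.stub_kestenOneArm) (hrel : RelativeUntrapping) :
    AnnularMassDecay :=
  AnnularMassDecay_of hdom harm (averagedUntrapping_of_relative hrel)

end Summit.CriticalPhenomena.SAWScalingLimit.Cruxes.AnnularMassDecay.KestenBridgeReferenceMeasure

end
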